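import Literature.NumberTheory.EllipticCurves.HidaFamilyGaloisRepDatum
import Literature.NumberTheory.EllipticCurves.OchiaiTwoVariableSelmerDual
import Summits.BirchSwinnertonDyer.BirchSwinnertonDyer.Theorems.OneSidedTwistSqueezeX9KatoDivisibilityX9ULedgerDefs
import Summits.BirchSwinnertonDyer.BirchSwinnertonDyer.Theorems.OneSidedTwistSqueezeX9KatoDivisibilityX9ULedgerWeightTwoPointDefs
import Summits.BirchSwinnertonDyer.BirchSwinnertonDyer.Theorems.OneSidedTwistSqueezeX9KatoDivisibilityX9ULedgerSpecialisationKernels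
import Mathlib.RingTheory.Ideal.GoingUp

set_option autoImplicit false

/-!
# The weight-two test: the one-point test `MonodromyShallowAt` from (W2ℚ_p) and the `E`-level depth digit
# (helpers for crux stmt-BirchSwinnertonDyer-20547 `KatoDivisibilityX9`, line `prime_adapted_tau`, stub 3 (U))

Port (verbatim, re-homed) of §E of the bsd-f3-mu cell's kernel-checked sketch `Sketch71.lean` v5 f376123484d02b28
(planner-bsd-f3-mu-desc g71; §E.0 = D65-U `U65.lean` §U2, desc g65; port plan PORT-PLAN-72 file P5 second half, desc
g72).  For a Hida datum `D : HidaFamilyGaloisRepDatum W p 𝕀` (tree), with `D.specLT`, `D.MonodromyShallowAt` of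
`…ULedgerDefs.lean` and (W2ℚ_p) `D.WeightTwoRational`, `iotaZp` of `…ULedgerWeightTwoPointDefs.lean`:

* §E.0 `specW` DETECTS UNITS (credit D65-U): `specLT_isPrime`, `comap_specLT`, `specLT_eq_maximalIdeal` — the elements of
  value `< 1` at the point of `W` form exactly `𝔪_𝕀` (a prime over `𝔪_Λ` in the integral extension `Λ → 𝕀` is maximal);
* `norm_specW_le_inv_of_not_isUnit` — under (W2ℚ_p) a NON-UNIT of `𝕀` has value of norm `≤ p⁻¹` (the gap below `1` in
  `|ℚ_p^×|`); `norm_add_le_of_le'`, `norm_conj_entry_le` (ultrametric bookkeeping);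
* `monodromyShallowAt_of_depthDigit` — LEMMA 71.3 (KERNEL, modulo the digit): under (W2ℚ_p), if `ρ_W(τ) − 1 ∉ p² End(T_p W)`
  then `D.MonodromyShallowAt τ` (both coordinates of the primitive direction in `𝔪` would put every entry of
  `A_τ − 1 = P⁻¹ specW(ν) P` in `p² ℤ̄_p`, `P, P⁻¹` integral by field (v));
* `specialisationTorsionFreeAt_of_digits` — PROP 71.4, FINAL KERNEL FORM: (Reg) ∧ (W2ℚ_p) ∧ one-parameter inertia with the
  tame relation ∧ the `E`-digits (`det = 1`, `tr = 2`, not `p²`-deep) ∧ `P_W = (ϖ)` ⟹ `D.SpecialisationTorsionFreeAt v`.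

No ledger item is closed here; BSD is proved for no curve.  References: [Ochiai2006] §3, Cor. 7.5 / Rem. 7.6;
[SerreLocalFields1979] Ch. II (unramified value groups); [Hida1986].
-/

noncomputable section

open scoped Classical MatrixGroups NumberField
open Matrix

namespace Literature.NumberTheory.EllipticCurves.HidaFamilyGaloisRepDatum

open Literature.NumberTheory.EllipticCurves Literature.NumberTheory.GaloisRepresentations
open Field IsDedekindDomain NumberField
open Summit.BirchSwinnertonDyer.BirchSwinnertonDyer.Theorems.OneSidedTwistSqueezeX9KatoDivisibilityX9ULedger

variable {W : WeierstrassCurve ℚ} {p : ℕ} [Fact p.Prime] {I : Type} [CommRing I] [IsDomain I]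
  [IsLocalRing I] [TopologicalSpace I] [IsTopologicalRing I] [Algebra (IwasawaAlgebra p) I]
  (D : HidaFamilyGaloisRepDatum W p I)

/-! ## §E.0 `specW` detects units (= D65-U `U65.lean` §U2; credit desc g65) -/

/-- `D.specLT` is a prime ideal (`specW` is multiplicative into a normed field and `‖specW x‖ ≤ 1`). -/
theorem specLT_isPrime : D.specLT.IsPrime := by
  refine ⟨?_, ?_⟩
  · rw [Ideal.ne_top_iff_one, mem_specLT, map_one, norm_one]
    exact lt_irrefl 1
  · intro x y hxy
    rw [mem_specLT, map_mul, norm_mul] at hxy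
    by_contra h
    rw [not_or, mem_specLT, mem_specLT, not_lt, not_lt] at h
    have hx : ‖D.specW x‖ = 1 := le_antisymm (D.norm_specW_le_one x) h.1
    have hy : ‖D.specW y‖ = 1 := le_antisymm (D.norm_specW_le_one y) h.2
    rw [hx, hy, mul_one] at hxy
    exact lt_irrefl _ hxy

/-- `D.specLT` lies over the maximal ideal of `Λ = ℤ_p⟦X⟧` (`specW ∘ algebraMap` is `X ↦ 0`, field (v)). -/
theorem comap_specLT :
    D.specLT.comap (algebraMap (IwasawaAlgebra p) I) = IsLocalRing.maximalIdeal (IwasawaAlgebra p) := by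
  ext f
  rw [Ideal.mem_comap, mem_specLT, D.specW_algebraMap, norm_algebraMap', ← PadicInt.norm_def,
    IsLocalRing.mem_maximalIdeal, mem_nonunits_iff, PowerSeries.isUnit_iff_constantCoeff,
    PadicInt.isUnit_iff]
  constructor
  · intro h h1
    rw [h1] at h
    exact lt_irrefl _ h
  · intro h
    exact lt_of_le_of_ne (PadicInt.norm_le_one _) h

/-- `specLT = 𝔪_𝕀` (a prime over the maximal ideal of `Λ` in the integral extension `Λ → 𝕀` is maximal). -/
theorem specLT_eq_maximalIdeal : D.specLT = IsLocalRing.maximalIdeal I := by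
  haveI := D.moduleFinite
  haveI : D.specLT.IsPrime := D.specLT_isPrime
  have hmax : D.specLT.IsMaximal :=
    Ideal.isMaximal_of_isIntegral_of_isMaximal_comap (R := IwasawaAlgebra p) D.specLT
      (by rw [comap_specLT]; exact IsLocalRing.maximalIdeal.isMaximal _)
  exact IsLocalRing.eq_maximalIdeal hmax

/-- Under `(W2ℚ_p)`: a NON-UNIT of `𝕀` has value of norm `≤ p⁻¹` at the point of `W` (unramified residue
field: the gap below `1` in `|ℚ_p^×|` is a whole power of `p`). -/
theorem norm_specW_le_inv_of_not_isUnit (hW2 : D.WeightTwoRational) {x : I} (hx : ¬ IsUnit x) :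
    ‖D.specW x‖ ≤ (p : ℝ)⁻¹ := by
  have hlt : ‖D.specW x‖ < 1 := by
    have hmem : x ∈ IsLocalRing.maximalIdeal I := hx
    rw [← D.specLT_eq_maximalIdeal, mem_specLT] at hmem
    exact hmem
  obtain ⟨z, hz⟩ := D.exists_specW_eq_iotaZp hW2 x
  rw [hz, norm_iotaZp] at hlt ⊢
  obtain ⟨w, hw⟩ := (PadicInt.norm_lt_one_iff_dvd z).mp hlt
  rw [hw, norm_mul, PadicInt.norm_p]
  exact mul_le_of_le_one_right (inv_nonneg.mpr (Nat.cast_nonneg _)) (PadicInt.norm_le_one w)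

omit [IsDomain I] [IsLocalRing I] [TopologicalSpace I] [IsTopologicalRing I] [Algebra (IwasawaAlgebra p) I] in
/-- Ultrametric inequality in `ℚ̄_p`, bounded form. -/
theorem norm_add_le_of_le' {a b : PadicAlgCl p} {r : ℝ} (ha : ‖a‖ ≤ r) (hb : ‖b‖ ≤ r) : ‖a + b‖ ≤ r :=
  (PadicAlgCl.isNonarchimedean p a b).trans (max_le ha hb)

omit [IsDomain I] [IsLocalRing I] [TopologicalSpace I] [IsTopologicalRing I] [Algebra (IwasawaAlgebra p) I] in
/-- Entries of `P N Q` are bounded by the entries of `N` when `P, Q` are integral (ultrametric). -/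
theorem norm_conj_entry_le {P Q N : Matrix (Fin 2) (Fin 2) (PadicAlgCl p)} {r : ℝ} (hr : 0 ≤ r)
    (hP : ∀ i j, ‖P i j‖ ≤ 1) (hQ : ∀ i j, ‖Q i j‖ ≤ 1) (hN : ∀ i j, ‖N i j‖ ≤ r) (i j : Fin 2) :
    ‖(P * N * Q) i j‖ ≤ r := by
  have h1 : ∀ k l, ‖P i k * N k l * Q l j‖ ≤ r := fun k l => by
    rw [norm_mul, norm_mul]
    calc ‖P i k‖ * ‖N k l‖ * ‖Q l j‖ ≤ 1 * r * 1 :=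
          mul_le_mul (mul_le_mul (hP i k) (hN k l) (norm_nonneg _) zero_le_one) (hQ l j) (norm_nonneg _)
            (by rw [one_mul]; exact hr)
      _ = r := by ring
  simp only [Matrix.mul_apply, Fin.sum_univ_two, add_mul]
  exact norm_add_le_of_le' (p := p) (norm_add_le_of_le' (p := p) (h1 0 0) (h1 1 0))
    (norm_add_le_of_le' (p := p) (h1 0 1) (h1 1 1))

/-- **LEMMA 71.3 (KERNEL, modulo the digit): the one-point test from `(W2ℚ_p)` and the depth digit.** -/
theorem monodromyShallowAt_of_depthDigit (hW2 : D.WeightTwoRational) {τ : absoluteGaloisGroup ℚ}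
    (hdepth : ∀ g : Module.End ℤ_[p] (W.tateModule p),
      W.galoisRepTate p τ - 1 ≠ ((p : ℤ_[p]) ^ 2) • g) :
    D.MonodromyShallowAt τ := by
  intro h e₁ e₂ hν _
  obtain ⟨b, P, hP, hPinv, hconj⟩ := D.exists_conj_galoisRepTate
  set A : Matrix (Fin 2) (Fin 2) ℤ_[p] := LinearMap.toMatrix b b (W.galoisRepTate p τ) with hA
  have hmapτ : (D.rhoMat τ).map D.specW =
      ((P : GL (Fin 2) (PadicAlgCl p)) : Matrix (Fin 2) (Fin 2) (PadicAlgCl p)) * A.map (iotaZp p) *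
        ((P⁻¹ : GL (Fin 2) (PadicAlgCl p)) : Matrix (Fin 2) (Fin 2) (PadicAlgCl p)) := by
    rw [rhoMat, hconj τ]
    rfl
  have hPP : ((P⁻¹ : GL (Fin 2) (PadicAlgCl p)) : Matrix (Fin 2) (Fin 2) (PadicAlgCl p)) *
      (((P : GL (Fin 2) (PadicAlgCl p)) : Matrix (Fin 2) (Fin 2) (PadicAlgCl p)) * A.map (iotaZp p) *
        ((P⁻¹ : GL (Fin 2) (PadicAlgCl p)) : Matrix (Fin 2) (Fin 2) (PadicAlgCl p))) *
      ((P : GL (Fin 2) (PadicAlgCl p)) : Matrix (Fin 2) (Fin 2) (PadicAlgCl p)) = A.map (iotaZp p) := by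
    simp only [← Matrix.mul_assoc]
    rw [Units.inv_mul, Matrix.one_mul, Matrix.mul_assoc, Units.inv_mul, Matrix.mul_one]
  -- `(A − 1) ⊗ ℚ̄_p = P⁻¹ · specW(ν) · P`
  have hkey : (A - 1).map (iotaZp p) =
      ((P⁻¹ : GL (Fin 2) (PadicAlgCl p)) : Matrix (Fin 2) (Fin 2) (PadicAlgCl p)) *
        (D.rhoMat τ - 1).map D.specW *
        ((P : GL (Fin 2) (PadicAlgCl p)) : Matrix (Fin 2) (Fin 2) (PadicAlgCl p)) := by
    rw [Matrix.map_sub _ (map_sub (iotaZp p)), Matrix.map_one _ (map_zero (iotaZp p)) (map_one (iotaZp p)),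
      Matrix.map_sub _ (map_sub D.specW), Matrix.map_one _ (map_zero D.specW) (map_one D.specW), hmapτ,
      Matrix.mul_sub, Matrix.sub_mul, Matrix.mul_one, hPP, Units.inv_mul]
  -- entry bounds transfer from `specW(ν)` to `A − 1`
  have hentry : ∀ r : ℝ, 0 ≤ r → (∀ k l, ‖D.specW ((D.rhoMat τ - 1) k l)‖ ≤ r) →
      ∀ i j, ‖(A - 1) i j‖ ≤ r := by
    intro r hr hN i j
    have := norm_conj_entry_le (p := p) (N := (D.rhoMat τ - 1).map D.specW) hr hPinv hP
      (fun k l => by rw [Matrix.map_apply]; exact hN k l) i j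
    rw [← hkey, Matrix.map_apply, norm_iotaZp] at this
    exact this
  -- the digit forbids `A − 1 ∈ p² M₂(ℤ_p)`
  have hdiv : ¬ ∀ i j, (A - 1) i j ∈ Ideal.span {((p : ℤ_[p]) ^ 2)} := by
    intro hall
    choose G hG using fun i j => Ideal.mem_span_singleton'.mp (hall i j)
    apply hdepth (Matrix.toLin b b (Matrix.of fun i j => G i j))
    apply (LinearMap.toMatrix b b).injective
    rw [map_sub, LinearMap.toMatrix_one, map_smul, LinearMap.toMatrix_toLin]
    ext i j
    rw [Matrix.smul_apply, Matrix.of_apply, smul_eq_mul, ← hG i j, mul_comm]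
  refine ⟨?_, ?_⟩
  · -- both coordinates in `𝔪_𝕀` ⟹ entries of `A − 1` of norm `≤ p⁻²` ⟹ `p² ∣ A − 1`
    by_contra hu
    rw [not_or] at hu
    have h1 := D.norm_specW_le_inv_of_not_isUnit hW2 hu.1
    have h2 := D.norm_specW_le_inv_of_not_isUnit hW2 hu.2
    have hp0 : (0 : ℝ) ≤ (p : ℝ)⁻¹ := inv_nonneg.mpr (Nat.cast_nonneg _)
    have hO : ∀ k l, ‖D.specW (outerNil e₁ e₂ k l)‖ ≤ (p : ℝ)⁻¹ * (p : ℝ)⁻¹ := by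
      intro k l
      fin_cases k <;> fin_cases l <;>
        simp only [outerNil, Matrix.of_apply, Matrix.cons_val', Matrix.cons_val_zero, Matrix.cons_val_one,
          Matrix.cons_val_fin_one, Matrix.empty_val', Fin.zero_eta, Fin.mk_one, Fin.isValue, map_neg, map_mul,
          norm_neg, norm_mul] <;>
        first
          | exact mul_le_mul h1 h2 (norm_nonneg _) hp0
          | exact mul_le_mul h1 h1 (norm_nonneg _) hp0
          | exact mul_le_mul h2 h2 (norm_nonneg _) hp0
          | exact mul_le_mul h2 h1 (norm_nonneg _) hp0
    have hN : ∀ k l, ‖D.specW ((D.rhoMat τ - 1) k l)‖ ≤ (p : ℝ)⁻¹ * (p : ℝ)⁻¹ := by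
      intro k l
      rw [hν, Matrix.smul_apply, smul_eq_mul, map_mul, norm_mul]
      exact (mul_le_mul (D.norm_specW_le_one h) (hO k l) (norm_nonneg _) zero_le_one).trans_eq (one_mul _)
    have hle := hentry _ (mul_nonneg hp0 hp0) hN
    have hpow : (p : ℝ)⁻¹ * (p : ℝ)⁻¹ = (p : ℝ) ^ (-(2 : ℕ) : ℤ) := by
      rw [_root_.zpow_neg, zpow_natCast, pow_two, mul_inv]
    exact hdiv fun i j => (PadicInt.norm_le_pow_iff_mem_span_pow _ 2).mp (by rw [← hpow]; exact hle i j)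
  · -- `specW h = 0` ⟹ `specW(ν) = 0` ⟹ `A = 1`
    intro hh
    rw [RingHom.mem_ker] at hh
    have hN : ∀ k l, ‖D.specW ((D.rhoMat τ - 1) k l)‖ ≤ 0 := by
      intro k l
      rw [hν, Matrix.smul_apply, smul_eq_mul, map_mul, hh, zero_mul, norm_zero]
    have h0 := hentry 0 le_rfl hN
    exact hdiv fun i j => by
      rw [norm_le_zero_iff.mp (h0 i j)]
      exact Submodule.zero_mem _

/-- **PROP 71.4 — FINAL KERNEL FORM (`(U)_v` at a multiplicative prime of an X9 pair, modulo digits).**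
Hypotheses: `𝕀` regular (Reg); `(W2ℚ_p)`; one-parameter inertia through `τ` and the tame relation
`ρ_D(φ τ φ⁻¹) = ρ_D(τ^ℓ)`, `ℓ ≥ 2` (STEP 1a; Galois-side, paper); the `E`-LEVEL DIGITS at `τ`: `ρ_W(τ)` unipotent
(`det = 1`, `tr = 2`) and NOT DEEP (`ρ_W(τ) − 1 ∉ p² End T_p W`, i.e. `m_v ≤ 1`); and `P_W = (ϖ)` principal.
Conclusion: `D.SpecialisationTorsionFreeAt v`.  Kernel chain: `sq_zero_of_tame_relation` (L71.1) →
`exists_normalForm` (L71.2) → `monodromyShallowAt_of_depthDigit` (L71.3) → `unimodularMonodromyAt_of_outerNil` →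
`specialisationTorsionFreeAt_of_unimodular` (L71.2 (a)). -/
theorem specialisationTorsionFreeAt_of_digits {v : HeightOneSpectrum (𝓞 ℚ)}
    {τ φ : absoluteGaloisGroup ℚ} {ℓ : ℕ} (hreg : Ochiai2006.IsRegular p I) (hW2 : D.WeightTwoRational)
    (hτ : D.OneParamInertiaAt v τ) (hℓ : 2 ≤ ℓ) (hrel : D.rhoMat (φ * τ * φ⁻¹) = D.rhoMat (τ ^ ℓ))
    (hdetW : LinearMap.det (W.galoisRepTate p τ) = 1)
    (htrW : LinearMap.trace ℤ_[p] _ (W.galoisRepTate p τ) = 2)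
    (hdepth : ∀ g : Module.End ℤ_[p] (W.tateModule p), W.galoisRepTate p τ - 1 ≠ ((p : ℤ_[p]) ^ 2) • g)
    {ϖ : I} (hϖ : Prime ϖ) (hker : RingHom.ker D.specW = Ideal.span {ϖ}) :
    D.SpecialisationTorsionFreeAt v :=
  D.specialisationTorsionFreeAt_of_tame_shallow hreg hτ hℓ hrel hdetW htrW
    (D.monodromyShallowAt_of_depthDigit hW2 hdepth) hϖ hker

end Literature.NumberTheory.EllipticCurves.HidaFamilyGaloisRepDatum
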